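import Summits.ResolutionOfSingularities.ResolutionOfSingularities.Theorems.HomologicalConductorNoZenoSplitCoverFloor
import HarnessLib

/-!
# Crux `NoZenoR` (stmt-ResolutionOfSingularities-19943), row 8⁗ — the ENDOMORPHISM TWO-TERM FLOOR
# (LEMMA F2): annihilating `Ext` out of a two-term cover by endomorphisms of the cover, not only by scalars

Route `ResolutionOfSingularities/HomologicalConductor`, chain W4.4, KERNEL-g17 §1 (lead g17).
`[OURS]` — AI-formalised, weaker than expert review; NOT a statement of any manuscript under review.

The tree has two «product floors» for the cohomology annihilator of a ring `A` carrying a split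
module-finite cover `B` (`B|_A ∈ add`-resolutions): the four-factor split-cover floor
`(ann_A Ext^{≥1}(B|_A, −))^{d+1} ⊆ ca^{d+1}(A)` (`…NoZenoSplitCoverFloor`, p612053) and the two-term floor
`J² ⊆ ca⁴(A)` from two-term `add(B|_A)`-resolutions of second syzygies (`…NoZenoTwoTermFloor`,
p618095). Both use SCALARS `c ∈ A` acting on `Ext`. KERNEL-g17's LEMMA F2 observes that when the
two-term cover `0 → Q₁ → Q₀ → E → 0` consists of `B`-modules and `B`-linear maps (e.g. `E = Hom_A(B, X)`
for an MCM `A`-module `X` over an isolated quotient threefold singularity `A = S^G ⊂ S = B`, where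
`pd_B E ≤ 1`), the whole long exact `Ext_A(−, N)`-sequence is `B`-linear, so ELEMENTS OF `B` — indeed
arbitrary endomorphisms of the short exact sequence — can be used as annihilators, and only their
PRODUCT has to come from `A`:

* `mk₀_comp_eq_zero_of_shortExact_of_endo` — abstract core, any abelian category: if `σ, τ` are
  endomorphisms of a short exact `0 → X₁ → X₂ → X₃ → 0`, precomposition with `σ₂` kills
  `Ext^{j+1}(X₂, N)` and precomposition with `τ₁` kills `Extʲ(X₁, N)`, then precomposition with
  `τ₃ ≫ σ₃` kills `Ext^{j+1}(X₃, N)` (exactness at `Ext^{j+1}(X₃, N)` plus Mathlib's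
  `ShortExact.extClass_naturality`);
* `smul_ext_eq_zero_of_retract_of_endo` — transport to a retract `X` of `X₃` on which a scalar `r`
  acts as `i ≫ φ ≫ p` with `φ` such an annihilating endomorphism;
* `smul_ext_eq_zero_of_coverEndo` — the module form (LEMMA F2): `A → B` commutative, `T` a short exact
  sequence of `B`-modules, `s, t ∈ B` with `s` killing `Ext^{≥ j+1}_A(T.X₂|_A, −)` and `t` killing
  `Ext^{≥ j}_A(T.X₁|_A, −)` (as endomorphisms), `X` an `A`-retract of `T.X₃|_A`, `r ∈ A` with
  `algebraMap r = u * t * s`: then `r ∈ ann_A Ext^{≥ j+1}_A(X, −)`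
  (`mem_extAnnihilatorFrom_of_coverEndo`), and the `ca`-corollary along syzygies
  (`mem_cohomologyAnnihilatorOfDegree_of_coverEndo`).

Model (KERNEL-g17 §1–§2, not typed here: no invariant-ring vocabulary in the tree): `A = R = ⅟5(1,3,2)`,
`B = S = k[y₁,y₂,y₃]`, `E = Hom_R(S, X)`, `𝔡_q = ann_S R^q Hom_R(S, −)`; the lemma gives
`sann_R(Ω^ℓ X) ⊇ R ∩ S·𝔡_{ℓ+1}·𝔡_ℓ` for every MCM `X`, whence the dichotomy of KERNEL-g17 §4
(`y₂²y₃² ∈ ca` iff `y₂y₃` stably annihilates some syzygy of the conic modules `S_1`, `S_4`).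
-/

noncomputable section

-- single-problem summit: the doubled namespace component is forced
set_option linter.dupNamespace false

open CategoryTheory CategoryTheory.Abelian CategoryTheory.Limits
open Literature.RingTheory.CohomologyAnnihilator

universe w v u

namespace Summit.ResolutionOfSingularities.ResolutionOfSingularities.Theorems.NoZeno.CoverEndoFloor

section Abelian

variable {C : Type u} [Category.{v} C] [Abelian C] [HasExt.{w} C]

/-- **Endomorphism two-term annihilation (abstract LEMMA F2).** Let `0 → X₁ → X₂ → X₃ → 0` be short
exact and let `σ, τ` be endomorphisms of the sequence. If precomposition with `σ.τ₂` kills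
`Ext^{j+1}(X₂, N)` and precomposition with `τ.τ₁` kills `Extʲ(X₁, N)`, then precomposition with
`τ.τ₃ ≫ σ.τ₃` kills `Ext^{j+1}(X₃, N)`: `σ₃^* e` restricts to `σ₂^*(g^* e) = 0` on `X₂`, so it is a
connecting image `δ x`, and `τ₃^* δ x = δ (τ₁^* x) = 0` by naturality of the extension class.
[this work; KERNEL-g17 §1.3] -/
theorem mk₀_comp_eq_zero_of_shortExact_of_endo {S : ShortComplex C} (hS : S.ShortExact)
    (σ τ : S ⟶ S) {N : C} {j : ℕ}
    (hσ : ∀ e : Ext.{w} S.X₂ N (j + 1), (Ext.mk₀ σ.τ₂).comp e (zero_add _) = 0)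
    (hτ : ∀ e : Ext.{w} S.X₁ N j, (Ext.mk₀ τ.τ₁).comp e (zero_add _) = 0)
    (e : Ext.{w} S.X₃ N (j + 1)) :
    (Ext.mk₀ (τ.τ₃ ≫ σ.τ₃)).comp e (zero_add _) = 0 := by
  have h0 : (Ext.mk₀ S.g).comp ((Ext.mk₀ σ.τ₃).comp e (zero_add _)) (zero_add _) = 0 := by
    rw [Ext.mk₀_comp_mk₀_assoc, ← σ.comm₂₃, ← Ext.mk₀_comp_mk₀_assoc, hσ]
  obtain ⟨x, hx⟩ := Ext.contravariant_sequence_exact₃ hS N _ h0 (add_comm 1 j)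
  rw [← Ext.mk₀_comp_mk₀_assoc, ← hx]
  have hassoc : (Ext.mk₀ τ.τ₃).comp (hS.extClass.comp x (add_comm 1 j)) (zero_add _) =
      ((Ext.mk₀ τ.τ₃).comp hS.extClass (zero_add 1)).comp x (add_comm 1 j) :=
    (Ext.comp_assoc _ _ _ (zero_add 1) (add_comm 1 j) (by omega)).symm
  rw [hassoc, ← hS.extClass_naturality hS τ, Ext.comp_assoc_of_second_deg_zero, hτ, Ext.comp_zero]

/-- The same with thresholds: if `σ.τ₂` kills `Ext^{≥ j+1}(X₂, N)` and `τ.τ₁` kills `Ext^{≥ j}(X₁, N)`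
then `τ.τ₃ ≫ σ.τ₃` kills `Ext^{≥ j+1}(X₃, N)`. [this work] -/
theorem mk₀_comp_eq_zero_of_shortExact_of_endo_of_le {S : ShortComplex C} (hS : S.ShortExact)
    (σ τ : S ⟶ S) {N : C} {j : ℕ}
    (hσ : ∀ i : ℕ, j + 1 ≤ i → ∀ e : Ext.{w} S.X₂ N i, (Ext.mk₀ σ.τ₂).comp e (zero_add _) = 0)
    (hτ : ∀ i : ℕ, j ≤ i → ∀ e : Ext.{w} S.X₁ N i, (Ext.mk₀ τ.τ₁).comp e (zero_add _) = 0)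
    {i : ℕ} (hi : j + 1 ≤ i) (e : Ext.{w} S.X₃ N i) :
    (Ext.mk₀ (τ.τ₃ ≫ σ.τ₃)).comp e (zero_add _) = 0 := by
  obtain ⟨i', rfl⟩ : ∃ i', i = i' + 1 := ⟨i - 1, by omega⟩
  exact mk₀_comp_eq_zero_of_shortExact_of_endo hS σ τ (hσ (i' + 1) hi)
    (fun e' => hτ i' (by omega) e') e

variable {R : Type*} [Ring R] [Linear R C]

/-- **Transport to a retract.** If `X` is a retract of `Y` (`i ≫ p = 𝟙`), `φ : Y ⟶ Y` kills `Extⁿ(Y, N)`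
by precomposition, and the homothety `r • 𝟙 X` factors as `i ≫ φ ≫ p`, then `r • Extⁿ(X, N) = 0`.
[this work] -/
theorem smul_ext_eq_zero_of_retract_of_endo {X Y N : C} (i : X ⟶ Y) (p : Y ⟶ X) (φ : Y ⟶ Y)
    {r : R} (h : i ≫ φ ≫ p = r • 𝟙 X) {n : ℕ}
    (hφ : ∀ e' : Ext.{w} Y N n, (Ext.mk₀ φ).comp e' (zero_add _) = 0) (e : Ext.{w} X N n) :
    r • e = 0 := by
  rw [smul_eq_mk₀_smul_id_comp, ← h, ← Ext.mk₀_comp_mk₀_assoc, ← Ext.mk₀_comp_mk₀_assoc, hφ,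
    Ext.comp_zero]

end Abelian

/-! ## The module form: `B`-scalars as annihilators of `Ext_A` out of a `B`-linear two-term cover -/

section Module

variable {A : Type u} [CommRing A] {B : Type u} [CommRing B] [Algebra A B]

omit [Algebra A B] in
/-- In a linear category, `(u • 𝟙) ≫ (t • 𝟙) ≫ (s • 𝟙) = (u * t * s) • 𝟙` … here only for `ModuleCat B`
endomorphisms pushed through a functor: `F (a • 𝟙 M) ≫ F (b • 𝟙 M) = F ((a * b) • 𝟙 M)`. [folklore] -/
theorem map_smul_id_comp_map_smul_id {D : Type*} [Category D] (F : ModuleCat.{u} B ⥤ D)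
    (M : ModuleCat.{u} B) (a b : B) :
    F.map (a • 𝟙 M) ≫ F.map (b • 𝟙 M) = F.map ((a * b) • 𝟙 M) := by
  rw [← F.map_comp, Linear.smul_comp, Category.id_comp, smul_smul]

/-- For a `B`-module `M` and `r ∈ A`, the homothety `r • 𝟙` of `M|_A` is the restriction of the
homothety `(algebraMap A B r) • 𝟙 M`. [folklore] -/
theorem smul_id_res_eq (M : ModuleCat.{u} B) (r : A) :
    r • 𝟙 ((restrictScalarsFunctor A B).obj M) = (restrictScalarsFunctor A B).map ((algebraMap A B r) • 𝟙 M) := by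
  ext m
  rfl

/-- **LEMMA F2, module form.** Let `T : 0 → Q₁ → Q₀ → E → 0` be a short exact sequence of
`B`-modules, `s t u ∈ B`, `r ∈ A` with `algebraMap r = u * t * s`. Suppose the homothety `s` kills
`Ext^{j+1}_A(Q₀|_A, N)` and the homothety `t` kills `Extʲ_A(Q₁|_A, N)` (as endomorphisms of the
restricted modules). Then for every `A`-retract `X` of `E|_A` (`i ≫ p = 𝟙 X`), `r • Ext^{j+1}_A(X, N) = 0`.
Model: `A = S^G ⊂ B = S`, `E = Hom_A(B, X)` for `X` MCM, `Q_i` free `B`-modules, `s ∈ 𝔡_{j+1}`,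
`t ∈ 𝔡_j` (KERNEL-g17 §1.3). [this work] -/
theorem smul_ext_eq_zero_of_coverEndo {T : ShortComplex (ModuleCat.{u} B)} (hT : T.ShortExact)
    {s t u : B} {r : A} (hr : algebraMap A B r = u * t * s) {j : ℕ} {N : ModuleCat.{u} A}
    (hs : ∀ e : Ext.{u} ((restrictScalarsFunctor A B).obj T.X₂) N (j + 1),
      (Ext.mk₀ ((restrictScalarsFunctor A B).map (s • 𝟙 T.X₂))).comp e (zero_add _) = 0)
    (ht : ∀ e : Ext.{u} ((restrictScalarsFunctor A B).obj T.X₁) N j,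
      (Ext.mk₀ ((restrictScalarsFunctor A B).map (t • 𝟙 T.X₁))).comp e (zero_add _) = 0)
    {X : ModuleCat.{u} A} (i : X ⟶ (restrictScalarsFunctor A B).obj T.X₃) (p : (restrictScalarsFunctor A B).obj T.X₃ ⟶ X)
    (hip : i ≫ p = 𝟙 X) (e : Ext.{u} X N (j + 1)) : r • e = 0 := by
  -- the restricted sequence and the two endomorphisms `s • 𝟙 T`, `t • 𝟙 T`
  have hT' : (T.map (restrictScalarsFunctor A B)).ShortExact := hT.map_of_exact (restrictScalarsFunctor A B)
  set σ : T.map (restrictScalarsFunctor A B) ⟶ T.map (restrictScalarsFunctor A B) := (restrictScalarsFunctor A B).mapShortComplex.map (s • 𝟙 T) with hσdef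
  set τ : T.map (restrictScalarsFunctor A B) ⟶ T.map (restrictScalarsFunctor A B) := (restrictScalarsFunctor A B).mapShortComplex.map (t • 𝟙 T) with hτdef
  have key : ∀ e' : Ext.{u} ((restrictScalarsFunctor A B).obj T.X₃) N (j + 1),
      (Ext.mk₀ (τ.τ₃ ≫ σ.τ₃)).comp e' (zero_add _) = 0 :=
    mk₀_comp_eq_zero_of_shortExact_of_endo hT' σ τ (fun e' => hs e') (fun e' => ht e')
  -- `τ₃ ≫ σ₃` is the homothety `t * s`, and `r • 𝟙 X = i ≫ (u • 𝟙) ≫ ((t * s) • 𝟙) ≫ p`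
  have hτσ : τ.τ₃ ≫ σ.τ₃ = (restrictScalarsFunctor A B).map ((t * s) • 𝟙 T.X₃) := by
    simp only [hσdef, hτdef, Functor.mapShortComplex_map_τ₃, ShortComplex.smul_τ₃,
      ShortComplex.id_τ₃]
    exact map_smul_id_comp_map_smul_id (restrictScalarsFunctor A B) T.X₃ t s
  have key' : ∀ e' : Ext.{u} ((restrictScalarsFunctor A B).obj T.X₃) N (j + 1),
      (Ext.mk₀ ((restrictScalarsFunctor A B).map ((t * s) • 𝟙 T.X₃))).comp e' (zero_add _) = 0 :=
    fun e' => hτσ ▸ key e'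
  have hmul : u * (t * s) = algebraMap A B r := by rw [hr, mul_assoc]
  have hfac : i ≫ ((restrictScalarsFunctor A B).map (u • 𝟙 T.X₃) ≫ (restrictScalarsFunctor A B).map ((t * s) • 𝟙 T.X₃)) ≫ p =
      r • 𝟙 X := by
    rw [map_smul_id_comp_map_smul_id, hmul, ← smul_id_res_eq, Linear.smul_comp, Category.id_comp,
      Linear.comp_smul, hip]
  refine smul_ext_eq_zero_of_retract_of_endo i p _ hfac (fun e' => ?_) e
  rw [← Ext.mk₀_comp_mk₀_assoc, key', Ext.comp_zero]

/-- **LEMMA F2 in `extAnnihilatorFrom` form.** With thresholds: `s` kills `Ext^{≥ j+1}_A(Q₀|_A, −)` and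
`t` kills `Ext^{≥ j}_A(Q₁|_A, −)` on finitely generated second arguments; then
`r ∈ ann_A Ext^{≥ j+1}_A(X, −)` for every `A`-retract `X` of `E|_A`. [this work] -/
theorem mem_extAnnihilatorFrom_of_coverEndo {T : ShortComplex (ModuleCat.{u} B)} (hT : T.ShortExact)
    {s t u : B} {r : A} (hr : algebraMap A B r = u * t * s) {j : ℕ}
    (hs : ∀ i : ℕ, j + 1 ≤ i → ∀ (N : ModuleCat.{u} A), Module.Finite A N →
      ∀ e : Ext.{u} ((restrictScalarsFunctor A B).obj T.X₂) N i,
        (Ext.mk₀ ((restrictScalarsFunctor A B).map (s • 𝟙 T.X₂))).comp e (zero_add _) = 0)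
    (ht : ∀ i : ℕ, j ≤ i → ∀ (N : ModuleCat.{u} A), Module.Finite A N →
      ∀ e : Ext.{u} ((restrictScalarsFunctor A B).obj T.X₁) N i,
        (Ext.mk₀ ((restrictScalarsFunctor A B).map (t • 𝟙 T.X₁))).comp e (zero_add _) = 0)
    {X : ModuleCat.{u} A} (i : X ⟶ (restrictScalarsFunctor A B).obj T.X₃) (p : (restrictScalarsFunctor A B).obj T.X₃ ⟶ X)
    (hip : i ≫ p = 𝟙 X) : r ∈ extAnnihilatorFrom X (j + 1) := by
  rw [mem_extAnnihilatorFrom_iff]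
  intro i' hi' N hN e
  obtain ⟨i'', rfl⟩ : ∃ i'', i' = i'' + 1 := ⟨i' - 1, by omega⟩
  exact smul_ext_eq_zero_of_coverEndo hT hr (hs (i'' + 1) hi' N hN) (ht i'' (by omega) N hN) i p hip e

/-- **The `ca`-corollary of LEMMA F2.** If every finitely generated `A`-module `M` has a `d`-th syzygy
`K = Ωᵈ M` which is an `A`-retract of the end of a short exact sequence of `B`-modules
`0 → Q₁ → Q₀ → E → 0` on which the fixed `B`-scalars `s`, `t` kill `Ext^{≥ j+1}_A(Q₀|_A, −)`,
`Ext^{≥ j}_A(Q₁|_A, −)` respectively, and `algebraMap r = u * t * s`, then `r ∈ ca^{j+1+d}(A)`.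
Model: `A` an isolated quotient threefold singularity, `d = 3`, `E = Hom_A(S, Ω³M)`, `Q_i` free
`S`-modules, `s ∈ 𝔡_{j+1}`, `t ∈ 𝔡_j`: `ca^{j+4}(A) ⊇ A ∩ S·𝔡_{j+1}·𝔡_j` (KERNEL-g17 §1.3 Cor.).
[this work] -/
theorem mem_cohomologyAnnihilatorOfDegree_of_coverEndo {s t u : B} {r : A}
    (hr : algebraMap A B r = u * t * s) {j d : ℕ}
    (h : ∀ (M : ModuleCat.{u} A), Module.Finite A M →
      ∃ (K : ModuleCat.{u} A) (T : ShortComplex (ModuleCat.{u} B)), IsSyzygy d M K ∧ T.ShortExact ∧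
        (∀ i : ℕ, j + 1 ≤ i → ∀ (N : ModuleCat.{u} A), Module.Finite A N →
          ∀ e : Ext.{u} ((restrictScalarsFunctor A B).obj T.X₂) N i,
            (Ext.mk₀ ((restrictScalarsFunctor A B).map (s • 𝟙 T.X₂))).comp e (zero_add _) = 0) ∧
        (∀ i : ℕ, j ≤ i → ∀ (N : ModuleCat.{u} A), Module.Finite A N →
          ∀ e : Ext.{u} ((restrictScalarsFunctor A B).obj T.X₁) N i,
            (Ext.mk₀ ((restrictScalarsFunctor A B).map (t • 𝟙 T.X₁))).comp e (zero_add _) = 0) ∧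
        ∃ (i : K ⟶ (restrictScalarsFunctor A B).obj T.X₃) (p : (restrictScalarsFunctor A B).obj T.X₃ ⟶ K), i ≫ p = 𝟙 K) :
    r ∈ cohomologyAnnihilatorOfDegree A (j + 1 + d) := by
  rw [mem_cohomologyAnnihilatorOfDegree_iff_forall_mem_extAnnihilatorFrom]
  intro M hM
  obtain ⟨K, T, hK, hT, hs, ht, i, p, hip⟩ := h M hM
  exact mem_extAnnihilatorFrom_of_isSyzygy d hK (mem_extAnnihilatorFrom_of_coverEndo hT hr hs ht i p hip)

end Module

end Summit.ResolutionOfSingularities.ResolutionOfSingularities.Theorems.NoZeno.CoverEndoFloor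

end
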